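import Summits.ValiantsHypothesis.ValiantsHypothesis.Theorems.MonotoneRestorationOrbitRestorationQPBlockProducts
import Summits.ValiantsHypothesis.ValiantsHypothesis.Theorems.MonotoneRestorationOrbitRestorationQPAffineFactors
import Literature.ModelTheory.FiniteModelTheory.SymmetricCircuitCountingWidthProofs
import HarnessLib

/-!
# Support blocks: a symmetric affine product with untwisted support blocks is orbit-restorable (ORBIT currency, XVII)

Route MonotoneRestoration, crux `OrbitRestorationQP` (stmt-ValiantsHypothesis-18293), namespace
`Summit.ValiantsHypothesis.ValiantsHypothesis.Theorems.SupportBlocks`.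

The `k = 1` sub-rung (ΠΣ) of the first rung of line `depth-three-rung`, SUPPORT-BLOCK form.  Let
`f = a · Π L` be a nonzero product of affine forms of degree `1`, invariant under the diagonal action of
`Sym(Fin n)`, and let `supp` be an equivariant, unit-invariant support assignment with `|supp ℓ| ≤ k` on the
factors (`AffineFactors.exists_support_of_mem_factors` provides supports of size `< k` for `|L| < C(n,k)`).
Group the factors into SUPPORT BLOCKS `G_T := Π {ℓ ∈ L : supp ℓ = T}`.  By unique factorisation every
`σ` carries `G_T` to a UNIT MULTIPLE of `G_{σ T}` (`exists_unit_block`); the units restricted to the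
set-stabiliser of `T` form a character of `Sym(T) × Sym(Fin n ∖ T)`, trivial on the second factor.  HYPOTHESIS
(TB, "untwisted blocks"): every transposition INSIDE `T` fixes `G_T`.  Then the character is trivial
(`ren_block_eq_of_smul_eq`: `Sym(T)` is generated by its transpositions, Mathlib `Perm.swap_induction_on`),
the blocks can be rescaled equivariantly by transport from one representative per cardinality
(`exists_perm_smul_eq`), and the block criterion `BlockProducts.qpOrbitRestorable_of_blocks` applies:
`f` is `QPOrbitRestorable (k + 5)` (`qpOrbitRestorable_of_untwisted_supportBlocks`).

(TB) holds e.g. for `Π_{i<j,k≠l}(x_ik − x_jl)`, for `Π_{i<j,k<l}(x_ik − x_jk − x_il + x_jl)`, for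
`Π_{i<j,k}(x_ik − x_jk)·Π_{k<l,i}(x_ik − x_il)` (`n` even); it FAILS for `Π_{i<j,k}(x_ik − x_jk)` alone
(`n` even), which is restorable by row-pair blocks instead — the general ΠΣ rung needs keyed blocks
(census of the seat, HOME notes).  Everything here is proved. [folklore]

## References
* A. Dawar, G. Wilsenach, *Symmetric arithmetic circuits*, ToC 21 (2025), §3.3, Def. 6.1. [DawarWilsenach2025]
-/

noncomputable section

open scoped Classical Pointwise

-- `Summit.ValiantsHypothesis.ValiantsHypothesis.…` is the tree's single-conjunct layout (Sub = Summit).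
set_option linter.dupNamespace false

namespace Summit.ValiantsHypothesis.ValiantsHypothesis.Theorems

namespace SupportBlocks

open Equiv Finset Literature.Computability.AlgebraicComplexity OrbitRestorationQPDepthThreeRung

variable {n : ℕ}

/-! ### Associates bookkeeping -/

/-- Associated polynomials over `ℂ` differ by a nonzero constant. [folklore] -/
theorem exists_C_of_associated {p q : MvPolynomial (Fin n × Fin n) ℂ} (h : Associated p q) :
    ∃ c : ℂ, c ≠ 0 ∧ q = MvPolynomial.C c * p := by
  obtain ⟨u, hu⟩ := h
  obtain ⟨r, hr, hur⟩ := MvPolynomial.isUnit_iff_eq_C_of_isReduced.1 u.isUnit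
  refine ⟨r, hr.ne_zero, ?_⟩
  rw [← hu, hur, mul_comm]

/-- Filtering two multisets with the same associates by a predicate that respects associates leaves the
same associates. [folklore] -/
theorem map_mk_filter_eq {P : MvPolynomial (Fin n × Fin n) ℂ → Prop} [DecidablePred P]
    (hP : ∀ p q, Associated p q → (P p ↔ P q)) {A B : Multiset (MvPolynomial (Fin n × Fin n) ℂ)}
    (h : A.map Associates.mk = B.map Associates.mk) :
    (A.filter P).map Associates.mk = (B.filter P).map Associates.mk := by
  let P' : Associates (MvPolynomial (Fin n × Fin n) ℂ) → Prop := fun x => ∃ q, Associates.mk q = x ∧ P q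
  have hP' : ∀ q, P' (Associates.mk q) ↔ P q := fun q =>
    ⟨fun ⟨q', hq', hPq'⟩ => (hP q' q (Associates.mk_eq_mk_iff_associated.1 hq')).1 hPq', fun h => ⟨q, rfl, h⟩⟩
  have key : ∀ C : Multiset (MvPolynomial (Fin n × Fin n) ℂ),
      (C.filter P).map Associates.mk = (C.map Associates.mk).filter P' := by
    intro C
    rw [Multiset.filter_map]
    congr 1
    exact Multiset.filter_congr fun q _ => (hP' q).symm
  rw [key, key, h]

/-! ### Unique factorisation: renaming permutes the factors up to units -/

/-- **Renaming permutes the factors up to associates.**  If `f = a · Π L` (degree-one factors) is nonzero and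
diagonally invariant then `L` and `σ · L` have the same associates. [folklore] -/
theorem map_mk_map_ren_eq {L : Multiset (MvPolynomial (Fin n × Fin n) ℂ)} {a : ℂ}
    (hL1 : ∀ ℓ ∈ L, ℓ.totalDegree = 1) (hf0 : MvPolynomial.C a * L.prod ≠ 0)
    (hfix : ∀ σ : Perm (Fin n), ren σ (MvPolynomial.C a * L.prod) = MvPolynomial.C a * L.prod)
    (σ : Perm (Fin n)) : (L.map (ren σ)).map Associates.mk = L.map Associates.mk := by
  have hirr : ∀ x ∈ L.map (ren σ), Irreducible x := by
    intro x hx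
    obtain ⟨ℓ, hℓ, rfl⟩ := Multiset.mem_map.1 hx
    exact AffineFactors.irreducible_of_totalDegree_eq_one (by rw [AffineFactors.totalDegree_ren, hL1 ℓ hℓ])
  have hirr' : ∀ x ∈ L, Irreducible x := fun x hx => AffineFactors.irreducible_of_totalDegree_eq_one (hL1 x hx)
  have ha : (MvPolynomial.C a : MvPolynomial (Fin n × Fin n) ℂ) ≠ 0 := by
    intro h; exact hf0 (by rw [h, zero_mul])
  have hprod : (L.map (ren σ)).prod = L.prod := by
    have h := hfix σ
    rw [map_mul, ren_C, map_multiset_prod] at h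
    exact mul_left_cancel₀ ha h
  exact Associates.rel_associated_iff_map_eq_map.1
    (UniqueFactorizationMonoid.factors_unique hirr hirr' (hprod ▸ Associated.refl _))

/-- **Support blocks are transported up to units.**  With a unit-invariant (`S1`) and equivariant (`S2`)
support assignment, `σ · G_T = c · G_{σ • T}` for a nonzero constant `c`, where
`G_T = Π {ℓ ∈ L : supp ℓ = T}`. [folklore] -/
theorem exists_unit_block {L : Multiset (MvPolynomial (Fin n × Fin n) ℂ)} {a : ℂ}
    (supp : MvPolynomial (Fin n × Fin n) ℂ → Finset (Fin n))
    (S1 : ∀ (q : MvPolynomial (Fin n × Fin n) ℂ) (u : ℂ), u ≠ 0 → supp (MvPolynomial.C u * q) = supp q)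
    (S2 : ∀ (q : MvPolynomial (Fin n × Fin n) ℂ) (σ : Perm (Fin n)), supp (ren σ q) = σ • supp q)
    (hL1 : ∀ ℓ ∈ L, ℓ.totalDegree = 1) (hf0 : MvPolynomial.C a * L.prod ≠ 0)
    (hfix : ∀ σ : Perm (Fin n), ren σ (MvPolynomial.C a * L.prod) = MvPolynomial.C a * L.prod)
    (σ : Perm (Fin n)) (T : Finset (Fin n)) :
    ∃ c : ℂ, c ≠ 0 ∧ ren σ (L.filter fun ℓ => supp ℓ = T).prod =
      MvPolynomial.C c * (L.filter fun ℓ => supp ℓ = σ • T).prod := by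
  have hP : ∀ p q : MvPolynomial (Fin n × Fin n) ℂ, Associated p q → (supp p = σ • T ↔ supp q = σ • T) := by
    intro p q hpq
    obtain ⟨c, hc0, rfl⟩ := exists_C_of_associated hpq
    rw [S1 p c hc0]
  have h1 := map_mk_filter_eq hP (map_mk_map_ren_eq hL1 hf0 hfix σ)
  -- the filtered renamed multiset is the renamed block
  have h2 : (L.map (ren σ)).filter (fun ℓ => supp ℓ = σ • T) = (L.filter fun ℓ => supp ℓ = T).map (ren σ) := by
    rw [Multiset.filter_map]
    congr 1
    refine Multiset.filter_congr fun ℓ _ => ?_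
    simp only [Function.comp_apply, S2]
    constructor
    · intro h; simpa using congrArg (fun S => σ⁻¹ • S) h
    · intro h; rw [h]
  rw [h2] at h1
  have h3 := congrArg Multiset.prod h1
  rw [Associates.prod_mk, Associates.prod_mk, Associates.mk_eq_mk_iff_associated, ← map_multiset_prod] at h3
  obtain ⟨c, hc0, hc⟩ := exists_C_of_associated h3.symm
  exact ⟨c, hc0, hc⟩

/-! ### Untwisted blocks are fixed by the set-stabiliser of their support -/

/-- **The set-stabiliser of `T` fixes an untwisted `T`-block.**  If every factor in the block is fixed by
the pointwise stabiliser of `T` and every transposition inside `T` fixes the block product, then every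
permutation mapping `T` to itself fixes the block product (`Sym(T)` is generated by transpositions).
[folklore] -/
theorem ren_block_eq_of_smul_eq {M : Multiset (MvPolynomial (Fin n × Fin n) ℂ)} {T : Finset (Fin n)}
    (hM : ∀ ℓ ∈ M, ∀ τ : Perm (Fin n), (∀ x ∈ T, τ x = x) → ren τ ℓ = ℓ)
    (hTB : ∀ x ∈ T, ∀ y ∈ T, ren (swap x y) M.prod = M.prod)
    (ρ : Perm (Fin n)) (hρ : ρ • T = T) : ren ρ M.prod = M.prod := by
  -- pointwise stabiliser
  have hpt : ∀ τ : Perm (Fin n), (∀ x ∈ T, τ x = x) → ren τ M.prod = M.prod := by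
    intro τ hτ
    rw [map_multiset_prod, Multiset.map_congr rfl fun ℓ hℓ => hM ℓ hℓ τ hτ, Multiset.map_id']
  -- permutations of `T` extended by the identity
  have hsub : ∀ π : Perm {x // x ∈ T}, ren (Perm.ofSubtype π) M.prod = M.prod := by
    intro π
    induction π using Perm.swap_induction_on with
    | one => rw [map_one, ren_one]
    | swap_mul π x y hxy ih => rw [map_mul, Perm.ofSubtype_swap_eq, ren_mul, ih, hTB x x.2 y y.2]
  -- decomposition `ρ = ρ₁ ρ₂`
  have hmem : ∀ x, x ∈ T ↔ ρ x ∈ T := by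
    intro x
    constructor
    · intro hx; rw [← hρ]; exact Finset.smul_mem_smul_finset hx
    · intro hx
      rw [← hρ, Finset.mem_smul_finset] at hx
      obtain ⟨y, hy, hxy⟩ := hx
      rw [Perm.smul_def] at hxy
      rwa [← ρ.injective hxy]
  have hmem' : ∀ x, ρ x ∈ T ↔ x ∈ T := fun x => (hmem x).symm
  set π : Perm {x // x ∈ T} := ρ.subtypePerm hmem' with hπ
  have hρ1 : ∀ x ∈ T, Perm.ofSubtype π x = ρ x := fun x hx => by
    rw [Perm.ofSubtype_apply_of_mem π hx]; rfl
  have hρ2 : ∀ x ∈ T, ((Perm.ofSubtype π)⁻¹ * ρ) x = x := by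
    intro x hx
    rw [Perm.mul_apply, Perm.inv_eq_iff_eq, hρ1 x hx]
  calc ren ρ M.prod = ren (Perm.ofSubtype π * ((Perm.ofSubtype π)⁻¹ * ρ)) M.prod := by
        rw [mul_inv_cancel_left]
    _ = M.prod := by rw [ren_mul, hpt _ hρ2, hsub]

/-! ### Transport between finite sets of the same size -/

/-- Two finite sets of indices of the same size are related by a permutation. [folklore] -/
theorem exists_perm_smul_eq {A B : Finset (Fin n)} (h : A.card = B.card) : ∃ ρ : Perm (Fin n), ρ • A = B := by
  let e : {x // x ∈ A} ≃ {x // x ∈ B} := Fintype.equivOfCardEq (by simp [h])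
  let f : Fin n → Fin n := fun x => if hx : x ∈ A then (e ⟨x, hx⟩ : Fin n) else x
  have hf : Set.InjOn f ↑A := by
    intro x hx y hy hxy
    simp only [Finset.mem_coe] at hx hy
    simp only [f, dif_pos hx, dif_pos hy] at hxy
    have := e.injective (Subtype.ext hxy)
    simpa using this
  obtain ⟨ρ, hρ⟩ := Literature.ModelTheory.FiniteModelTheory.exists_perm_extend A f hf
  refine ⟨ρ, ?_⟩
  apply Finset.eq_of_subset_of_card_le
  · intro y hy
    obtain ⟨x, hx, rfl⟩ := Finset.mem_smul_finset.1 hy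
    rw [Perm.smul_def, hρ x hx]
    simp only [f, dif_pos hx]
    exact (e ⟨x, hx⟩).2
  · rw [Finset.card_smul_finset, h]

/-! ### Fibrewise product -/

/-- The product of a multiset is the product over all fibres of any map into a finite type. [folklore] -/
theorem prod_filter_eq_prod {ι : Type} [Fintype ι] [DecidableEq ι] (g : MvPolynomial (Fin n × Fin n) ℂ → ι)
    (L : Multiset (MvPolynomial (Fin n × Fin n) ℂ)) :
    ∏ T : ι, (L.filter fun ℓ => g ℓ = T).prod = L.prod := by
  induction L using Multiset.induction_on with
  | empty => simp
  | cons ℓ L ih =>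
    have hsplit : ∀ T : ι, ((ℓ ::ₘ L).filter fun ℓ' => g ℓ' = T).prod =
        (if g ℓ = T then ℓ else 1) * (L.filter fun ℓ' => g ℓ' = T).prod := by
      intro T
      rw [Multiset.filter_cons]
      split_ifs with h
      · rw [Multiset.singleton_add, Multiset.prod_cons]
      · rw [zero_add, one_mul]
    simp only [hsplit]
    rw [Finset.prod_mul_distrib, ih, Finset.prod_ite_eq, if_pos (Finset.mem_univ _), Multiset.prod_cons]

/-! ### The support-block theorem -/

/-- **A DIAGONALLY SYMMETRIC AFFINE PRODUCT WITH UNTWISTED SUPPORT BLOCKS IS ORBIT-RESTORABLE.**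
Let `f = a · Π L ≠ 0` be a product of degree-one forms on the `n × n` matrix, invariant under the diagonal
action of `Sym(Fin n)`; let `supp` assign finite sets of indices with (S1) `supp (u · q) = supp q` (`u ≠ 0`),
(S2) `supp (σ · q) = σ • supp q`, (S3) the pointwise stabiliser of `supp ℓ` fixes each factor `ℓ`, (S4)
`|supp ℓ| ≤ k`; and suppose (TB) every transposition inside `T` fixes the block `Π {ℓ ∈ L : supp ℓ = T}`, for
every `T`.  Then `f` is `QPOrbitRestorable (k + 5)` at level `n`. [folklore; cite: DawarWilsenach2025 §3.3] -/
theorem qpOrbitRestorable_of_untwisted_supportBlocks {k : ℕ} (L : Multiset (MvPolynomial (Fin n × Fin n) ℂ))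
    (a : ℂ) (supp : MvPolynomial (Fin n × Fin n) ℂ → Finset (Fin n))
    (S1 : ∀ (q : MvPolynomial (Fin n × Fin n) ℂ) (u : ℂ), u ≠ 0 → supp (MvPolynomial.C u * q) = supp q)
    (S2 : ∀ (q : MvPolynomial (Fin n × Fin n) ℂ) (σ : Perm (Fin n)), supp (ren σ q) = σ • supp q)
    (S3 : ∀ ℓ ∈ L, ∀ τ : Perm (Fin n), (∀ x ∈ supp ℓ, τ x = x) → ren τ ℓ = ℓ)
    (S4 : ∀ ℓ ∈ L, (supp ℓ).card ≤ k)
    (hL1 : ∀ ℓ ∈ L, ℓ.totalDegree = 1) (hf0 : MvPolynomial.C a * L.prod ≠ 0)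
    (hfix : ∀ σ : Perm (Fin n), ren σ (MvPolynomial.C a * L.prod) = MvPolynomial.C a * L.prod)
    (hTB : ∀ (T : Finset (Fin n)), ∀ x ∈ T, ∀ y ∈ T,
      ren (swap x y) (L.filter fun ℓ => supp ℓ = T).prod = (L.filter fun ℓ => supp ℓ = T).prod) :
    QPOrbitRestorable (k + 5) n (MvPolynomial.C a * L.prod) := by
  -- blocks, representatives per cardinality, transporting permutations
  set blk : Finset (Fin n) → Multiset (MvPolynomial (Fin n × Fin n) ℂ) := fun T => L.filter fun ℓ => supp ℓ = T
    with hblk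
  let repc : ℕ → Finset (Fin n) := fun t => if h : ∃ S : Finset (Fin n), S.card = t then Classical.choose h else ∅
  have hrepc : ∀ T : Finset (Fin n), (repc T.card).card = T.card := fun T => by
    have h : ∃ S : Finset (Fin n), S.card = T.card := ⟨T, rfl⟩
    simp only [repc, dif_pos h]
    exact Classical.choose_spec h
  have hex : ∀ T : Finset (Fin n), ∃ ρ : Perm (Fin n), ρ • repc T.card = T := fun T =>
    exists_perm_smul_eq (hrepc T)
  choose tr htr using hex
  -- renamed factors keep a support
  have hS3' : ∀ ℓ ∈ L, ∀ (σ τ : Perm (Fin n)), (∀ x ∈ σ • supp ℓ, τ x = x) → ren τ (ren σ ℓ) = ren σ ℓ := by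
    intro ℓ hℓ σ τ hτ
    have hfix' : ren (σ⁻¹ * τ * σ) ℓ = ℓ := S3 ℓ hℓ _ fun x hx => by
      have h1 : τ (σ • x) = σ • x := hτ (σ • x) (Finset.smul_mem_smul_finset hx)
      rw [Perm.smul_def] at h1
      rw [Perm.mul_apply, Perm.mul_apply, h1]
      exact σ.symm_apply_apply x
    calc ren τ (ren σ ℓ) = ren σ (ren (σ⁻¹ * τ * σ) ℓ) := by
          rw [← ren_mul, ← ren_mul, ← mul_assoc, ← mul_assoc, mul_inv_cancel, one_mul]
      _ = ren σ ℓ := by rw [hfix']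
  -- the set-stabiliser of a representative fixes its block
  have hstab : ∀ (T : Finset (Fin n)) (ρ : Perm (Fin n)), ρ • T = T → ren ρ (blk T).prod = (blk T).prod := by
    intro T ρ hρ
    refine ren_block_eq_of_smul_eq (fun ℓ hℓ τ hτ => ?_) (hTB T) ρ hρ
    have hℓ' := Multiset.mem_filter.1 hℓ
    exact S3 ℓ hℓ'.1 τ (hℓ'.2 ▸ hτ)
  -- the rescaled blocks
  set M : Finset (Fin n) → Multiset (MvPolynomial (Fin n × Fin n) ℂ) := fun T => (blk (repc T.card)).map (ren (tr T))
    with hM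
  -- each rescaled block is a unit multiple of the true block
  have hunit : ∀ T : Finset (Fin n), ∃ c : ℂ, c ≠ 0 ∧ (M T).prod = MvPolynomial.C c * (blk T).prod := by
    intro T
    obtain ⟨c, hc0, hc⟩ := exists_unit_block supp S1 S2 hL1 hf0 hfix (tr T) (repc T.card)
    refine ⟨c, hc0, ?_⟩
    rw [hM]; dsimp only
    rw [← map_multiset_prod, hblk]; dsimp only
    rw [hc, htr T]
  choose c hc0 hc using hunit
  have hcprod : (∏ T : Finset (Fin n), c T) ≠ 0 := Finset.prod_ne_zero_iff.2 fun T _ => hc0 T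
  -- `f` as a block product
  have hblkprod : (∏ T : Finset (Fin n), (blk T).prod) = L.prod := by
    simp only [hblk]; exact prod_filter_eq_prod supp L
  have hf : MvPolynomial.C a * L.prod =
      MvPolynomial.C (a * (∏ T : Finset (Fin n), c T)⁻¹) * ∏ T : Finset (Fin n), (M T).prod := by
    have h1 : (∏ T : Finset (Fin n), (M T).prod) = MvPolynomial.C (∏ T : Finset (Fin n), c T) * L.prod := by
      simp only [hc]
      rw [Finset.prod_mul_distrib, ← map_prod, hblkprod]
    rw [h1, ← mul_assoc, ← map_mul, show a * (∏ T : Finset (Fin n), c T)⁻¹ * ∏ T : Finset (Fin n), c T = a by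
      rw [mul_assoc, inv_mul_cancel₀ hcprod, mul_one]]
  rw [hf]
  refine BlockProducts.qpOrbitRestorable_of_blocks (k := k) M _ (fun T q hq => ?_) (fun T q hq => ?_)
    (fun T => ?_) (fun σ T => ?_)
  · -- affine
    rw [hM] at hq
    obtain ⟨ℓ, hℓ, rfl⟩ := Multiset.mem_map.1 hq
    rw [AffineFactors.totalDegree_ren, hL1 ℓ (Multiset.mem_filter.1 hℓ).1]
  · -- supported by `T`
    rw [hM] at hq
    obtain ⟨ℓ, hℓ, rfl⟩ := Multiset.mem_map.1 hq
    obtain ⟨hℓL, hℓT⟩ := Multiset.mem_filter.1 hℓ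
    refine ⟨T, ?_, fun τ hτ => hS3' ℓ hℓL (tr T) τ ?_⟩
    · rw [← hrepc T, ← hℓT]; exact S4 ℓ hℓL
    · rwa [hℓT, htr T]
  · -- exactly permuted by the pointwise stabiliser of `T`
    by_cases hemp : blk (repc T.card) = 0
    · refine ⟨∅, by simp, fun τ _ => ?_⟩
      rw [hM]; dsimp only
      rw [hemp, Multiset.map_zero, Multiset.map_zero]
    · obtain ⟨ℓ₀, hℓ₀⟩ := Multiset.exists_mem_of_ne_zero hemp
      obtain ⟨hℓ₀L, hℓ₀T⟩ := Multiset.mem_filter.1 hℓ₀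
      refine ⟨T, ?_, fun τ hτ => ?_⟩
      · rw [← hrepc T, ← hℓ₀T]; exact S4 ℓ₀ hℓ₀L
      · rw [hM]; dsimp only
        rw [Multiset.map_map]
        refine Multiset.map_congr rfl fun ℓ hℓ => ?_
        obtain ⟨hℓL, hℓT⟩ := Multiset.mem_filter.1 hℓ
        exact hS3' ℓ hℓL (tr T) τ (by rwa [hℓT, htr T])
  · -- equivariance of the rescaled block products
    rw [hM]; dsimp only
    rw [← map_multiset_prod, ← map_multiset_prod, ← ren_mul, Finset.card_smul_finset]
    -- `σ ∘ tr T` and `tr (σ • T)` both carry the representative to `σ • T`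
    have h1 : tr (σ • T) • repc T.card = σ • T := by
      have := htr (σ • T)
      rwa [Finset.card_smul_finset] at this
    have hρ : ((tr (σ • T))⁻¹ * (σ * tr T)) • repc T.card = repc T.card := by
      rw [mul_smul, mul_smul, htr T, inv_smul_eq_iff, h1]
    calc ren (σ * tr T) (blk (repc T.card)).prod
        = ren (tr (σ • T) * ((tr (σ • T))⁻¹ * (σ * tr T))) (blk (repc T.card)).prod := by
          rw [mul_inv_cancel_left]
      _ = ren (tr (σ • T)) (blk (repc T.card)).prod := by rw [ren_mul, hstab _ _ hρ]

end SupportBlocks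

end Summit.ValiantsHypothesis.ValiantsHypothesis.Theorems

end
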